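import Literature.NumberTheory.LFunctions.ClassGroupXi
import Literature.NumberTheory.LFunctions.SymmetricHadamardExpansion
import HarnessLib

/-!
# The symmetric pair `Ξ_χ(s) = ξ(s, χ) ξ(s, χ⁻¹)` of a class group `L`-function

Topic `Literature/NumberTheory/LFunctions` (namespace `Literature.NumberTheory.LFunctions.NumberField`),
continuing `ClassGroupXi.lean` (`ξ(s, χ) = s(s−1)γ_K(s)L(s,χ)` entire, `ξ(1 − s, χ) = W(χ)ξ(s, χ⁻¹)`).
Everything here is PROVED (one definition with body, `classXiPair`, and theorems).

The PAIR `Ξ_χ(s) = ξ(s, χ)ξ(s, χ⁻¹)` (`classXiPair`) is entire, SYMMETRIC (`Ξ_χ(1 − s) = Ξ_χ(s)`, as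
`W(χ)W(χ⁻¹) = 1`), of growth `exp(‖s‖^{31/16})`, with all zeros in `Re s ≤ 1`; so the tree's symmetric
Hadamard expansion applies (`nonempty_symmHadamardData_classXiPair`).  For `χ ≠ 1`, `Ξ_χ` has an (at
least) double zero at `s = 1` (`classXiPair_one`); for a real `χ` every zero of `ξ(·,χ)` is a multiple
zero of `Ξ_χ = ξ(·,χ)²` (`classXiPair_eq_zero_of_real`).  On `Re s > 1`:
`Ξ_χ'/Ξ_χ(s) = 2/s + 2/(s−1) + 2γ_K'/γ_K(s) + L'/L(s, χ) + L'/L(s, χ⁻¹)` (`logDeriv_classXiPair`).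

This is the device "`F = Λ(s,χ)Λ(s,χ̄)` is symmetric even when `Λ(s,χ)` is not" used to run
Hadamard-product (Stark / Deuring–Heilbronn) arguments for non-real characters
[cite: LagariasMontgomeryOdlyzko1979, §3] [cite: ThornerZaman2017, §7].

## References

* J. C. Lagarias, H. L. Montgomery, A. M. Odlyzko, Invent. Math. 54 (1979), §3. [LagariasMontgomeryOdlyzko1979]
* J. Thorner, A. Zaman, Algebra Number Theory 11 (2017), §7. [ThornerZaman2017]
* H. M. Stark, Invent. Math. 23 (1974), Lemma 3. [Stark1974]
-/

noncomputable section

open scoped NumberField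
open Complex Filter Topology Set Metric NumberField NumberField.InfinitePlace

namespace Literature.NumberTheory.LFunctions.NumberField

variable {K : Type*} [Field K] [NumberField K]

/-! ### The symmetric pair `Ξ_χ = ξ(·, χ) ξ(·, χ⁻¹)` -/

variable (K) in
/-- **`Ξ_χ(s) = ξ(s, χ) ξ(s, χ⁻¹)`**, entire and symmetric under `s ↦ 1 − s`.
[cite: LagariasMontgomeryOdlyzko1979, §3] -/
def classXiPair (χ : ClassGroup (𝓞 K) →* ℂˣ) (s : ℂ) : ℂ := classXi K χ s * classXi K χ⁻¹ s

/-- `Ξ_χ` is entire. [folklore] -/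
theorem differentiable_classXiPair (χ : ClassGroup (𝓞 K) →* ℂˣ) :
    Differentiable ℂ (classXiPair K χ) :=
  (differentiable_classXi χ).mul (differentiable_classXi χ⁻¹)

/-- **`Ξ_χ(1 − s) = Ξ_χ(s)`** (`W(χ)W(χ⁻¹) = 1`). [cite: LagariasMontgomeryOdlyzko1979, §3] -/
theorem classXiPair_one_sub (χ : ClassGroup (𝓞 K) →* ℂˣ) (s : ℂ) :
    classXiPair K χ (1 - s) = classXiPair K χ s := by
  rw [classXiPair, classXiPair, classXi_one_sub χ s, classXi_one_sub χ⁻¹ s, classGroupChar_inv_inv]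
  have h := classRootNumber_mul_inv (K := K) χ
  linear_combination (classXi K χ⁻¹ s * classXi K χ s) * h

/-- Growth of the pair: `‖Ξ_χ(s)‖ ≤ C exp(‖s‖^{31/16})`. [folklore] -/
theorem exists_norm_classXiPair_le (χ : ClassGroup (𝓞 K) →* ℂˣ) :
    ∃ C : ℝ, ∀ s : ℂ, ‖classXiPair K χ s‖ ≤ C * Real.exp (‖s‖ ^ (31 / 16 : ℝ)) := by
  obtain ⟨C₁, hC₁0, hC₁⟩ := exists_norm_classXi_le (K := K) χ
  obtain ⟨C₂, hC₂0, hC₂⟩ := exists_norm_classXi_le (K := K) χ⁻¹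
  obtain ⟨A, hA0, hA⟩ := Stark1974.exists_mul_add_rpow_le (μ := 15 / 8) (μ' := 31 / 16) (c := 2)
    (a := 0) (by norm_num) (by norm_num) (by norm_num) le_rfl
  refine ⟨C₁ * C₂ * Real.exp A, fun s ↦ ?_⟩
  rw [classXiPair, norm_mul]
  have h2 : 2 * ‖s‖ ^ (15 / 8 : ℝ) ≤ ‖s‖ ^ (31 / 16 : ℝ) + A := by
    have := hA ‖s‖ (norm_nonneg s); rwa [zero_add] at this
  calc ‖classXi K χ s‖ * ‖classXi K χ⁻¹ s‖
      ≤ (C₁ * Real.exp (‖s‖ ^ (15 / 8 : ℝ))) * (C₂ * Real.exp (‖s‖ ^ (15 / 8 : ℝ))) :=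
        mul_le_mul (hC₁ s) (hC₂ s) (norm_nonneg _) (by positivity)
    _ = C₁ * C₂ * Real.exp (2 * ‖s‖ ^ (15 / 8 : ℝ)) := by rw [two_mul, Real.exp_add]; ring
    _ ≤ C₁ * C₂ * Real.exp (‖s‖ ^ (31 / 16 : ℝ) + A) := by gcongr
    _ = C₁ * C₂ * Real.exp A * Real.exp (‖s‖ ^ (31 / 16 : ℝ)) := by rw [Real.exp_add]; ring

/-- The zeros of `Ξ_χ` have `Re s ≤ 1` (indeed `0 ≤ Re s ≤ 1`). [folklore] -/
theorem re_le_one_of_classXiPair_eq_zero (χ : ClassGroup (𝓞 K) →* ℂˣ) {s : ℂ}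
    (hs : classXiPair K χ s = 0) : s.re ≤ 1 := by
  rcases mul_eq_zero.mp hs with h | h
  · exact (re_mem_of_classXi_eq_zero χ h).2
  · exact (re_mem_of_classXi_eq_zero χ⁻¹ h).2

/-- `Ξ_χ(s) ≠ 0` for `Re s > 1`. [folklore] -/
theorem classXiPair_ne_zero_of_one_lt_re (χ : ClassGroup (𝓞 K) →* ℂˣ) {s : ℂ} (hs : 1 < s.re) :
    classXiPair K χ s ≠ 0 :=
  mul_ne_zero (classXi_ne_zero_of_one_lt_re χ hs) (classXi_ne_zero_of_one_lt_re χ⁻¹ hs)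

/-- **The symmetric Hadamard expansion applies to `Ξ_χ`.** [cite: Stark1974, Lemma 3] -/
theorem nonempty_symmHadamardData_classXiPair (χ : ClassGroup (𝓞 K) →* ℂˣ) :
    Nonempty (Stark1974.SymmHadamardData (classXiPair K χ)) := by
  obtain ⟨C, hC⟩ := exists_norm_classXiPair_le (K := K) χ
  exact Stark1974.exists_symmHadamardData (differentiable_classXiPair χ) (classXiPair_one_sub χ)
    (by norm_num : (31 / 16 : ℝ) < 2) (by norm_num) hC (fun s hs ↦ re_le_one_of_classXiPair_eq_zero χ hs)

/-- If both `ξ(ρ, χ) = 0` and `ξ(ρ, χ⁻¹) = 0` then `ρ` is a multiple zero of `Ξ_χ`: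
`Ξ_χ(ρ) = 0` and `Ξ_χ'(ρ) = 0`. [folklore] -/
theorem classXiPair_eq_zero_and_deriv_eq_zero (χ : ClassGroup (𝓞 K) →* ℂˣ) {ρ : ℂ}
    (h₁ : classXi K χ ρ = 0) (h₂ : classXi K χ⁻¹ ρ = 0) :
    classXiPair K χ ρ = 0 ∧ deriv (classXiPair K χ) ρ = 0 := by
  refine ⟨by rw [classXiPair, h₁, zero_mul], ?_⟩
  have hd := ((differentiable_classXi (K := K) χ ρ).hasDerivAt.mul
    (differentiable_classXi (K := K) χ⁻¹ ρ).hasDerivAt).deriv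
  have : classXiPair K χ = classXi K χ * classXi K χ⁻¹ := rfl
  rw [this, hd, h₁, h₂]; ring

/-- For `χ ≠ 1`, `s = 1` is a multiple zero of `Ξ_χ`. [folklore] -/
theorem classXiPair_one {χ : ClassGroup (𝓞 K) →* ℂˣ} (hχ : χ ≠ 1) :
    classXiPair K χ 1 = 0 ∧ deriv (classXiPair K χ) 1 = 0 :=
  classXiPair_eq_zero_and_deriv_eq_zero χ (classXi_one hχ) (classXi_one fun h ↦ hχ (by
    rw [← classGroupChar_inv_inv χ, h]; ext C; simp))

/-- For a REAL character (`χ⁻¹ = χ`), every zero of `ξ(·, χ)` is a multiple zero of `Ξ_χ = ξ(·,χ)²`.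
[folklore] -/
theorem classXiPair_eq_zero_of_real {χ : ClassGroup (𝓞 K) →* ℂˣ} (hχ : χ⁻¹ = χ) {ρ : ℂ}
    (h : classXi K χ ρ = 0) : classXiPair K χ ρ = 0 ∧ deriv (classXiPair K χ) ρ = 0 :=
  classXiPair_eq_zero_and_deriv_eq_zero χ h (by rw [hχ]; exact h)

/-! ### The logarithmic derivative on `Re s > 1` -/

/-- On `Re s > 1`:
`Ξ_χ'/Ξ_χ(s) = 2/s + 2/(s − 1) + 2 γ_K'/γ_K(s) + L'/L(s, χ) + L'/L(s, χ⁻¹)`. [folklore] -/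
theorem logDeriv_classXiPair (χ : ClassGroup (𝓞 K) →* ℂˣ) {s : ℂ} (hs : 1 < s.re) :
    logDeriv (classXiPair K χ) s = 2 / s + 2 / (s - 1) + 2 * logDeriv (dedekindGammaFactor K) s +
      logDeriv (classGroupLFunction K χ) s + logDeriv (classGroupLFunction K χ⁻¹) s := by
  have hs0 : 0 < s.re := by linarith
  have hs1 : s ≠ 1 := fun h ↦ by rw [h, one_re] at hs; exact lt_irrefl _ hs
  have hsne0 : s ≠ 0 := fun h ↦ by rw [h, zero_re] at hs; linarith
  have hU : ∀ᶠ z : ℂ in 𝓝 s, 1 < z.re := (isOpen_lt continuous_const continuous_re).mem_nhds hs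
  -- near `s`, `ξ(z, ψ) = (z (z−1)) · (γ(z) L(z, ψ))`
  have hev : ∀ ψ : ClassGroup (𝓞 K) →* ℂˣ, classXi K ψ =ᶠ[𝓝 s]
      fun z ↦ (z * (z - 1)) * (dedekindGammaFactor K z * classGroupLFunction K ψ z) := by
    intro ψ
    filter_upwards [hU] with z hz
    have hz1 : z ≠ 1 := fun h ↦ by rw [h, one_re] at hz; exact lt_irrefl _ hz
    exact classXi_eq_mul ψ (lt_trans zero_lt_one hz) hz1
  have hγd : DifferentiableAt ℂ (dedekindGammaFactor K) s :=
    differentiableAt_dedekindGammaFactor (ne_neg_nat_of_re_pos hs0)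
  have hγ0 : dedekindGammaFactor K s ≠ 0 := dedekindGammaFactor_ne_zero_of_re_pos hs0
  have hLd : ∀ ψ : ClassGroup (𝓞 K) →* ℂˣ, DifferentiableAt ℂ (classGroupLFunction K ψ) s := fun ψ ↦
    (differentiableOn_classGroupLFunction ψ).differentiableAt (isOpen_compl_singleton.mem_nhds hs1)
  have hL0 : ∀ ψ : ClassGroup (𝓞 K) →* ℂˣ, classGroupLFunction K ψ s ≠ 0 := fun ψ ↦
    classGroupLFunction_ne_zero_of_one_lt_re K ψ hs
  have hpoly : logDeriv (fun z : ℂ ↦ z * (z - 1)) s = 1 / s + 1 / (s - 1) := by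
    rw [logDeriv_mul (f := fun z : ℂ ↦ z) (g := fun z : ℂ ↦ z - 1) s hsne0 (sub_ne_zero.mpr hs1)
      differentiableAt_id (differentiableAt_id.sub_const 1)]
    rw [show (fun z : ℂ ↦ z) = id from rfl, logDeriv_id]
    have : logDeriv (fun z : ℂ ↦ z - 1) s = 1 / (s - 1) := by
      rw [logDeriv_apply, deriv_sub_const, deriv_id'']
    rw [this]
  have hψ : ∀ ψ : ClassGroup (𝓞 K) →* ℂˣ, logDeriv (classXi K ψ) s =
      1 / s + 1 / (s - 1) + logDeriv (dedekindGammaFactor K) s + logDeriv (classGroupLFunction K ψ) s := by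
    intro ψ
    rw [logDeriv_congr_of_eventuallyEq (hev ψ), logDeriv_mul (f := fun z : ℂ ↦ z * (z - 1))
      (g := fun z ↦ dedekindGammaFactor K z * classGroupLFunction K ψ z) s
      (mul_ne_zero hsne0 (sub_ne_zero.mpr hs1)) (mul_ne_zero hγ0 (hL0 ψ))
      (differentiableAt_id.mul (differentiableAt_id.sub_const 1)) (hγd.mul (hLd ψ)),
      hpoly, logDeriv_mul (f := dedekindGammaFactor K) (g := classGroupLFunction K ψ) s hγ0 (hL0 ψ)
        hγd (hLd ψ)]
    ring
  have hpair : classXiPair K χ = fun z ↦ classXi K χ z * classXi K χ⁻¹ z := rfl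
  rw [hpair, logDeriv_mul (f := classXi K χ) (g := classXi K χ⁻¹) s
    (classXi_ne_zero_of_one_lt_re χ hs) (classXi_ne_zero_of_one_lt_re χ⁻¹ hs)
    (differentiable_classXi χ s) (differentiable_classXi χ⁻¹ s), hψ χ, hψ χ⁻¹]
  ring

end Literature.NumberTheory.LFunctions.NumberField

end
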